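import Summits.Ventures.CertifiedManyBodySolver.Theorems.TcThermcert1GcFugacityNormalization
import Mathlib
import HarnessLib

/-!
# The normalisation logarithm `ℓ = log(z₂/((1+ζ↑)(1+ζ↓)))` of the two-fugacity atomic limit (K2 groundwork, part 2)

Helper file for route `TcThermcert1`, crux `ThermalStiffnessCeilingU8b10_le_1o8` (item `stmt-Ventures-26381`), line
`Cruxes/ThermalStiffnessCeilingU8b10_le_1o8/Lines/zerofree_corridor.lean` v9, registered stub K2 `stub_gcHighTempAnalytic`, step S2 of
`Cruxes/…/STUB-PLAN-stub_gcHighTempAnalytic.md`.  K2 normalises the two-fugacity grand-canonical trace by `(1+ζ↑)^{L²}(1+ζ↓)^{L²}`, whereas the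
polymer representation (part 1, `trace_exp_neg_onSiteSum_add_logFugacity`) normalises by the atomic limit `z₂^{L²}`,
`z₂ = 1+ζ↑+ζ↓+ζ↑ζ↓e^{−βU}`.  The discrepancy is the factor `e^{L² ℓ(ζ)}` with `ℓ = log(z₂/((1+ζ↑)(1+ζ↓)))`, which is the part of K2's
function `h` that does not come from the cluster expansion.  On the annulus pair `2/3 < |ζ_σ| < 8/9` and for `‖βU‖ ≤ 1/256`:

* `norm_zTwo_div_sub_one_le` — `‖z₂/((1+ζ↑)(1+ζ↓)) − 1‖ ≤ 128‖βU‖` (from `‖ζ↑ζ↓‖ ≤ 64/81`, `‖e^{−βU}−1‖ ≤ 2‖βU‖`, part 0's `‖(1+ζ↑)(1+ζ↓)‖ ≥ 1/81`);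
  hence `≤ 1/2`, `zTwo_ne_zero`, and the ratio lies in the slit plane (`zTwo_div_mem_slitPlane`);
* `norm_log_zTwo_div_le` — `‖ℓ‖ ≤ 192‖βU‖` (`‖log(1+u)‖ ≤ (3/2)‖u‖` for `‖u‖ ≤ 1/2`);
* `analyticOnNhd_log_zTwo_div` — `ℓ` is analytic in `(ζ↑, ζ↓) ∈ ℂ²` jointly on the open annulus pair (`AnalyticAt.clog` on the slit plane);
* `zTwo_pow_eq_mul_cexp` — `z₂^n = (1+ζ↑)^n (1+ζ↓)^n e^{n ℓ}` (the normalisation change, `n = L²`).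

So K2's `h` will be `ℓ + L⁻²·log Ξ`, with `‖ℓ‖ ≤ ε/2` as soon as `η₀ ≤ ε/(384|U|)` (and `η₀|U| ≤ 1/256`).  [folklore] Elementary estimates;
no physics claim — nothing about superconductivity in the Hubbard model is proved by anything in this file. No definitions; no `sorry`.
-/

noncomputable section

namespace Summit.Ventures.CertifiedManyBodySolver.Theorems.TcThermcert1.ZeroFreeCorridor

open Complex

/-! ## §1 The one-site normalisation ratio `z₂/((1+ζ↑)(1+ζ↓))` on the annulus pair -/

/-- `‖e^{-x} − 1‖ ≤ 2‖x‖` for `‖x‖ ≤ 1`. -/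
theorem norm_cexp_neg_sub_one_le {x : ℂ} (hx : ‖x‖ ≤ 1) : ‖cexp (-x) - 1‖ ≤ 2 * ‖x‖ := by
  have h := Complex.norm_exp_sub_one_le (x := -x) (by rwa [norm_neg])
  rwa [norm_neg] at h

/-- The algebra of the ratio: `z₂/p − 1 = ζ↑ζ↓(e^{−βU} − 1)/p`, `p = (1+ζ↑)(1+ζ↓) ≠ 0`. -/
theorem zTwo_div_sub_one_eq {a b E : ℂ} (hp : (1 + a) * (1 + b) ≠ 0) :
    (1 + a + b + a * b * E) / ((1 + a) * (1 + b)) - 1 = a * b * (E - 1) / ((1 + a) * (1 + b)) := by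
  rw [div_sub_one hp]
  congr 1
  ring

/-- **The ratio is `1 + O(βU)`**: on the annulus pair, for `‖βU‖ ≤ 1`,
`‖(1+ζ↑+ζ↓+ζ↑ζ↓e^{−βU})/((1+ζ↑)(1+ζ↓)) − 1‖ ≤ 128 ‖βU‖`. -/
theorem norm_zTwo_div_sub_one_le {ζ : ℂ × ℂ}
    (hζ : ζ ∈ ({ζ : ℂ | 2 / 3 < ‖ζ‖ ∧ ‖ζ‖ < 8 / 9} ×ˢ {ζ : ℂ | 2 / 3 < ‖ζ‖ ∧ ‖ζ‖ < 8 / 9})) {β U : ℂ} (hβU : ‖β * U‖ ≤ 1) :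
    ‖(1 + ζ.1 + ζ.2 + ζ.1 * ζ.2 * cexp (-(β * U))) / ((1 + ζ.1) * (1 + ζ.2)) - 1‖ ≤ 128 * ‖β * U‖ := by
  obtain ⟨h1, h2⟩ := Set.mem_prod.mp hζ
  have hp1 := one_add_ne_zero_of_mem_annulus h1
  have hp2 := one_add_ne_zero_of_mem_annulus h2
  have hp : (1 + ζ.1) * (1 + ζ.2) ≠ 0 := mul_ne_zero hp1 hp2
  have hlow := (site_ratio_le_of_mem_annulus hζ).1
  rw [zTwo_div_sub_one_eq hp, norm_div, norm_mul, norm_mul, div_le_iff₀ (norm_pos_iff.mpr hp)]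
  have hE := norm_cexp_neg_sub_one_le hβU
  have ha : ‖ζ.1‖ ≤ 8 / 9 := h1.2.le
  have hb : ‖ζ.2‖ ≤ 8 / 9 := h2.2.le
  have hab : ‖ζ.1‖ * ‖ζ.2‖ ≤ 64 / 81 := by
    have := mul_le_mul ha hb (norm_nonneg _) (by norm_num); linarith
  calc ‖ζ.1‖ * ‖ζ.2‖ * ‖cexp (-(β * U)) - 1‖ ≤ 64 / 81 * (2 * ‖β * U‖) :=
        mul_le_mul hab hE (norm_nonneg _) (by norm_num)
    _ ≤ 128 * ‖β * U‖ * ‖(1 + ζ.1) * (1 + ζ.2)‖ := by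
        nlinarith [mul_nonneg (norm_nonneg (β * U)) (sub_nonneg.mpr hlow)]

/-- Hence for `‖βU‖ ≤ 1/256` the ratio is within `1/2` of `1`; in particular `z₂ ≠ 0` and the ratio lies in the slit plane. -/
theorem norm_zTwo_div_sub_one_le_half {ζ : ℂ × ℂ}
    (hζ : ζ ∈ ({ζ : ℂ | 2 / 3 < ‖ζ‖ ∧ ‖ζ‖ < 8 / 9} ×ˢ {ζ : ℂ | 2 / 3 < ‖ζ‖ ∧ ‖ζ‖ < 8 / 9})) {β U : ℂ} (hβU : ‖β * U‖ ≤ 1 / 256) :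
    ‖(1 + ζ.1 + ζ.2 + ζ.1 * ζ.2 * cexp (-(β * U))) / ((1 + ζ.1) * (1 + ζ.2)) - 1‖ ≤ 1 / 2 := by
  have := norm_zTwo_div_sub_one_le hζ (hβU.trans (by norm_num))
  linarith

/-- `z₂ = 1+ζ↑+ζ↓+ζ↑ζ↓e^{−βU} ≠ 0` on the annulus pair for `‖βU‖ ≤ 1/256`. -/
theorem zTwo_ne_zero {ζ : ℂ × ℂ}
    (hζ : ζ ∈ ({ζ : ℂ | 2 / 3 < ‖ζ‖ ∧ ‖ζ‖ < 8 / 9} ×ˢ {ζ : ℂ | 2 / 3 < ‖ζ‖ ∧ ‖ζ‖ < 8 / 9})) {β U : ℂ} (hβU : ‖β * U‖ ≤ 1 / 256) :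
    1 + ζ.1 + ζ.2 + ζ.1 * ζ.2 * cexp (-(β * U)) ≠ 0 := by
  intro h0
  have := norm_zTwo_div_sub_one_le_half hζ hβU
  rw [h0, zero_div, zero_sub, norm_neg, norm_one] at this
  linarith

/-- The ratio lies in the slit plane (so its principal logarithm is analytic). -/
theorem zTwo_div_mem_slitPlane {ζ : ℂ × ℂ}
    (hζ : ζ ∈ ({ζ : ℂ | 2 / 3 < ‖ζ‖ ∧ ‖ζ‖ < 8 / 9} ×ˢ {ζ : ℂ | 2 / 3 < ‖ζ‖ ∧ ‖ζ‖ < 8 / 9})) {β U : ℂ} (hβU : ‖β * U‖ ≤ 1 / 256) :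
    (1 + ζ.1 + ζ.2 + ζ.1 * ζ.2 * cexp (-(β * U))) / ((1 + ζ.1) * (1 + ζ.2)) ∈ slitPlane := by
  have h := norm_zTwo_div_sub_one_le_half hζ hβU
  have : (1 + ζ.1 + ζ.2 + ζ.1 * ζ.2 * cexp (-(β * U))) / ((1 + ζ.1) * (1 + ζ.2)) =
      1 + ((1 + ζ.1 + ζ.2 + ζ.1 * ζ.2 * cexp (-(β * U))) / ((1 + ζ.1) * (1 + ζ.2)) - 1) := by ring
  rw [this]
  exact mem_slitPlane_of_norm_lt_one (by linarith)

/-! ## §2 The normalisation logarithm `ℓ = log(z₂/((1+ζ↑)(1+ζ↓)))`: size, analyticity, and the power identity -/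

/-- `‖log(1+u)‖ ≤ (3/2)‖u‖` for `‖u‖ ≤ 1/2`. -/
theorem norm_log_one_add_le_of_le_half {u : ℂ} (hu : ‖u‖ ≤ 1 / 2) : ‖Complex.log (1 + u)‖ ≤ 3 / 2 * ‖u‖ := by
  have h := Complex.norm_log_one_add_sub_self_le (z := u) (by linarith)
  have hi : (1 - ‖u‖)⁻¹ ≤ 2 := by
    rw [inv_le_comm₀ (by linarith) (by norm_num)]; linarith
  have h2 : ‖u‖ ^ 2 * (1 - ‖u‖)⁻¹ / 2 ≤ ‖u‖ / 2 := by
    have h3 : ‖u‖ ^ 2 * (1 - ‖u‖)⁻¹ ≤ ‖u‖ ^ 2 * 2 := mul_le_mul_of_nonneg_left hi (sq_nonneg _)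
    nlinarith [norm_nonneg u]
  calc ‖Complex.log (1 + u)‖ = ‖(Complex.log (1 + u) - u) + u‖ := by rw [sub_add_cancel]
    _ ≤ ‖Complex.log (1 + u) - u‖ + ‖u‖ := norm_add_le _ _
    _ ≤ 3 / 2 * ‖u‖ := by linarith

/-- **Size of the normalisation logarithm**: `‖log(z₂/((1+ζ↑)(1+ζ↓)))‖ ≤ 192 ‖βU‖` on the annulus pair for `‖βU‖ ≤ 1/256`. -/
theorem norm_log_zTwo_div_le {ζ : ℂ × ℂ}
    (hζ : ζ ∈ ({ζ : ℂ | 2 / 3 < ‖ζ‖ ∧ ‖ζ‖ < 8 / 9} ×ˢ {ζ : ℂ | 2 / 3 < ‖ζ‖ ∧ ‖ζ‖ < 8 / 9})) {β U : ℂ} (hβU : ‖β * U‖ ≤ 1 / 256) :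
    ‖Complex.log ((1 + ζ.1 + ζ.2 + ζ.1 * ζ.2 * cexp (-(β * U))) / ((1 + ζ.1) * (1 + ζ.2)))‖ ≤ 192 * ‖β * U‖ := by
  set v := (1 + ζ.1 + ζ.2 + ζ.1 * ζ.2 * cexp (-(β * U))) / ((1 + ζ.1) * (1 + ζ.2)) with hv
  have h1 := norm_zTwo_div_sub_one_le hζ (hβU.trans (by norm_num))
  have h2 := norm_zTwo_div_sub_one_le_half hζ hβU
  have := norm_log_one_add_le_of_le_half h2
  rw [add_sub_cancel] at this
  linarith

/-- **Analyticity of the normalisation logarithm** in the two fugacities jointly, on the (open) annulus pair, for `‖βU‖ ≤ 1/256`. -/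
theorem analyticOnNhd_log_zTwo_div {β U : ℂ} (hβU : ‖β * U‖ ≤ 1 / 256) :
    AnalyticOnNhd ℂ (fun ζ : ℂ × ℂ => Complex.log ((1 + ζ.1 + ζ.2 + ζ.1 * ζ.2 * cexp (-(β * U))) / ((1 + ζ.1) * (1 + ζ.2))))
      ({ζ : ℂ | 2 / 3 < ‖ζ‖ ∧ ‖ζ‖ < 8 / 9} ×ˢ {ζ : ℂ | 2 / 3 < ‖ζ‖ ∧ ‖ζ‖ < 8 / 9}) := by
  intro ζ hζ
  obtain ⟨h1, h2⟩ := Set.mem_prod.mp hζ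
  have hfst : AnalyticAt ℂ (fun ζ : ℂ × ℂ => ζ.1) ζ := analyticAt_fst
  have hsnd : AnalyticAt ℂ (fun ζ : ℂ × ℂ => ζ.2) ζ := analyticAt_snd
  have hnum : AnalyticAt ℂ (fun ζ : ℂ × ℂ => 1 + ζ.1 + ζ.2 + ζ.1 * ζ.2 * cexp (-(β * U))) ζ :=
    ((analyticAt_const.add hfst).add hsnd).add ((hfst.mul hsnd).mul analyticAt_const)
  have hden : AnalyticAt ℂ (fun ζ : ℂ × ℂ => (1 + ζ.1) * (1 + ζ.2)) ζ :=
    (analyticAt_const.add hfst).mul (analyticAt_const.add hsnd)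
  have hq := hnum.div hden (mul_ne_zero (one_add_ne_zero_of_mem_annulus h1) (one_add_ne_zero_of_mem_annulus h2))
  exact hq.clog (zTwo_div_mem_slitPlane hζ hβU)

/-- **The power identity**: `z₂^n = ((1+ζ↑)(1+ζ↓))^n · exp(n · log(z₂/((1+ζ↑)(1+ζ↓))))` — the normalisation change of K2 (`n = L²`):
the reference `z₂^{L²}` of the two-fugacity polymer representation equals K2's `(1+ζ↑)^{L²}(1+ζ↓)^{L²}` times `e^{L² ℓ}`. -/
theorem zTwo_pow_eq_mul_cexp {ζ : ℂ × ℂ}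
    (hζ : ζ ∈ ({ζ : ℂ | 2 / 3 < ‖ζ‖ ∧ ‖ζ‖ < 8 / 9} ×ˢ {ζ : ℂ | 2 / 3 < ‖ζ‖ ∧ ‖ζ‖ < 8 / 9})) {β U : ℂ} (hβU : ‖β * U‖ ≤ 1 / 256) (n : ℕ) :
    (1 + ζ.1 + ζ.2 + ζ.1 * ζ.2 * cexp (-(β * U))) ^ n =
      (1 + ζ.1) ^ n * (1 + ζ.2) ^ n *
        cexp ((n : ℂ) * Complex.log ((1 + ζ.1 + ζ.2 + ζ.1 * ζ.2 * cexp (-(β * U))) / ((1 + ζ.1) * (1 + ζ.2)))) := by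
  obtain ⟨h1, h2⟩ := Set.mem_prod.mp hζ
  have hp : (1 + ζ.1) * (1 + ζ.2) ≠ 0 := mul_ne_zero (one_add_ne_zero_of_mem_annulus h1) (one_add_ne_zero_of_mem_annulus h2)
  have hv : (1 + ζ.1 + ζ.2 + ζ.1 * ζ.2 * cexp (-(β * U))) / ((1 + ζ.1) * (1 + ζ.2)) ≠ 0 :=
    div_ne_zero (zTwo_ne_zero hζ hβU) hp
  rw [Complex.exp_nat_mul, Complex.exp_log hv, ← mul_pow, ← mul_pow, mul_div_cancel₀ _ hp]

end Summit.Ventures.CertifiedManyBodySolver.Theorems.TcThermcert1.ZeroFreeCorridor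

end
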